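import Summits.ValiantsHypothesis.ValiantsHypothesis.Theorems.AnyonJetsJetConstantElimPaddingPlumbing
import Mathlib.Data.List.GetD
import HarnessLib

/-!
# AnyonJets — crux `JetConstantElim` (stmt-ValiantsHypothesis-16737), stub `stub_integralMultiple`:
# restriction of scalars for constant-free circuits, I — tuples of available polynomials and the
# coordinate invariant

Route-independent toolkit (no `Theses` import, no definitions, no `sorry`) for the BOUNDED-DEGREE
slice of the OPEN stub `stub_integralMultiple` of line `Cruxes/JetConstantElim/Lines/birth.lean`:
constants in a number field `K` of degree `d + 1` are simulated on integer coordinates with respect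
to a `ℚ`-basis `β` of `K` with `β 0 = 1` and an INTEGER multiplication table
`β a · β b = Σ_l γ_{abl} β l` (e.g. the power basis of an algebraic integer), the structure
constants entering as fresh indeterminates `Γ_{abl}` (so that the simulating circuit stays
sign-constant) to be substituted at the end (Bürgisser–Clausen–Shokrollahi 1997 §4.1 flavour:
`L_k ≤ O(d³) · L_K` for `[K:k] = d`).

* `sc_avail_tuple_sum`, `sc_avail_bilinear` — coordinatewise signed sums (`d + 1` gates) and the
  bilinear forms `Σ_{(a,b)} A_a B_b Γ_{abl}` (`3` gates per index pair) in the sign-constant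
  availability plumbing of `…PaddingPlumbing`.
* `inv_scalarVar`, `inv_KVar`, `inv_const`, `inv_sum`, `inv_prod` — the COORDINATE INVARIANT
  `aeval ρK v = Σ_l C(β l) · (aeval ρZ (q l))^K` of a source value `v ∈ ℤ[α ⊕ κ]` (`α` scalar
  variables, `κ` variables read in `K`) with coordinate tuple `q` over the target variables
  `α ⊕ ((κ × Fin (d+1)) ⊕ (Fin (d+1))³)`, for evaluations `ρK`, `ρZ` tied by `hsc`, `hK`, `hβ`;
  closed under leaves, signed sums and products.

The gate-by-gate pass is `AnyonJetsJetConstantElimScalarRestriction.lean`. Honest framing: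
bookkeeping for a free slice; the stub's content (polynomial degree AND height of the field of
definition of near-optimal circuits) is untouched; VP ≠ VNP is NOT proved here.

References: P. Bürgisser, M. Clausen, M. A. Shokrollahi, *Algebraic Complexity Theory* (1997),
§4.1 (change of scalars); P. Bürgisser, *Completeness and Reduction …* (2000), §4.1.
-/

noncomputable section

-- single-conjunct layout: Sub = Summit, duplicated namespace component intended
set_option linter.dupNamespace false

namespace Summit.ValiantsHypothesis.ValiantsHypothesis.Theorems.AnyonJets.JetConstantElim

open MvPolynomial Literature.Computability.AlgebraicComplexity
open Literature.Computability.AlgebraicComplexity.ArithCircuit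
open scoped BigOperators

/-! ### Tuples of available polynomials: signed sums and bilinear products -/

section Tuples

variable {τ : Type*} {d : ℕ}

/-- Coordinatewise signed sum of two available `(d+1)`-tuples: `d + 1` sum gates.
[cite: Burgisser2000, Def. 2.1] -/
theorem sc_avail_tuple_sum {gs : List (Gate ℤ τ)}
    (hg : ∀ g ∈ gs, g.fanIn ≤ 2 ∧ g.HasSignConstants) {a b : ℤ} (ha : IsSignConstant a)
    (hb : IsSignConstant b) {A B : Fin (d + 1) → MvPolynomial τ ℤ}
    (hA : ∀ l, ∃ u : Operand ℤ τ, u.RefsBelow gs.length ∧ u.HasSignConstants ∧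
      u.eval (gateValues gs) = A l)
    (hB : ∀ l, ∃ u : Operand ℤ τ, u.RefsBelow gs.length ∧ u.HasSignConstants ∧
      u.eval (gateValues gs) = B l) :
    ∀ L : List (Fin (d + 1)), ∃ gs' : List (Gate ℤ τ), gs <+: gs' ∧
      (∀ g ∈ gs', g.fanIn ≤ 2 ∧ g.HasSignConstants) ∧ gs'.length ≤ gs.length + L.length ∧
      ∀ l ∈ L, ∃ u : Operand ℤ τ, u.RefsBelow gs'.length ∧ u.HasSignConstants ∧
        u.eval (gateValues gs') = a • A l + b • B l := by
  intro L
  induction L with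
  | nil => exact ⟨gs, List.prefix_rfl, hg, by simp, fun l hl => absurd hl (by simp)⟩
  | cons l L ih =>
    obtain ⟨gs₁, hpre₁, hg₁, hlen₁, hav₁⟩ := ih
    obtain ⟨gs₂, hpre₂, hg₂, hlen₂, hav₂⟩ :=
      sc_extend_sum hg₁ ha hb (sc_avail_mono hpre₁ (hA l)) (sc_avail_mono hpre₁ (hB l))
    refine ⟨gs₂, hpre₁.trans hpre₂, hg₂, by simp; omega, fun l' hl' => ?_⟩
    rcases List.mem_cons.mp hl' with rfl | hmem
    · exact hav₂
    · exact sc_avail_mono hpre₂ (hav₁ l' hmem)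

/-- The bilinear form `Σ_{(a,b) ∈ L} A_a · B_b · Γ_{a b l}` of two available tuples against the
structure-constant INDETERMINATES `Γ_{a b l}` (given as available polynomials `G a b`), along a
list `L` of index pairs: `3 |L|` gates. [cite: Burgisser2000, §4.1] -/
theorem sc_avail_bilinear {gs : List (Gate ℤ τ)}
    (hg : ∀ g ∈ gs, g.fanIn ≤ 2 ∧ g.HasSignConstants)
    {A B : Fin (d + 1) → MvPolynomial τ ℤ} {G : Fin (d + 1) → Fin (d + 1) → MvPolynomial τ ℤ}
    (hA : ∀ l, ∃ u : Operand ℤ τ, u.RefsBelow gs.length ∧ u.HasSignConstants ∧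
      u.eval (gateValues gs) = A l)
    (hB : ∀ l, ∃ u : Operand ℤ τ, u.RefsBelow gs.length ∧ u.HasSignConstants ∧
      u.eval (gateValues gs) = B l)
    (hG : ∀ a b, ∃ u : Operand ℤ τ, u.RefsBelow gs.length ∧ u.HasSignConstants ∧
      u.eval (gateValues gs) = G a b) :
    ∀ L : List (Fin (d + 1) × Fin (d + 1)), ∃ gs' : List (Gate ℤ τ), gs <+: gs' ∧
      (∀ g ∈ gs', g.fanIn ≤ 2 ∧ g.HasSignConstants) ∧ gs'.length ≤ gs.length + 3 * L.length ∧
      ∃ u : Operand ℤ τ, u.RefsBelow gs'.length ∧ u.HasSignConstants ∧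
        u.eval (gateValues gs') = (L.map fun ab => A ab.1 * B ab.2 * G ab.1 ab.2).sum := by
  intro L
  induction L with
  | nil => exact ⟨gs, List.prefix_rfl, hg, by simp, by simpa using sc_avail_C gs isSignConstant_zero⟩
  | cons ab L ih =>
    obtain ⟨gs₁, hpre₁, hg₁, hlen₁, hS⟩ := ih
    obtain ⟨gs₂, hpre₂, hg₂, hlen₂, ht₁⟩ :=
      sc_extend_prod hg₁ (sc_avail_mono hpre₁ (hA ab.1)) (sc_avail_mono hpre₁ (hB ab.2))
    obtain ⟨gs₃, hpre₃, hg₃, hlen₃, ht₂⟩ :=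
      sc_extend_prod hg₂ ht₁ (sc_avail_mono (hpre₁.trans hpre₂) (hG ab.1 ab.2))
    obtain ⟨gs₄, hpre₄, hg₄, hlen₄, ht₃⟩ :=
      sc_extend_sum hg₃ isSignConstant_one isSignConstant_one ht₂
        (sc_avail_mono (hpre₂.trans hpre₃) hS)
    refine ⟨gs₄, hpre₁.trans (hpre₂.trans (hpre₃.trans hpre₄)), hg₄, by simp; omega, ?_⟩
    obtain ⟨u, hu, hus, hue⟩ := ht₃
    exact ⟨u, hu, hus, by rw [hue, List.map_cons, List.sum_cons, one_smul, one_smul]⟩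

end Tuples

/-! ### The coordinate invariant of the simulation (algebra)

Source circuit over `ℤ` in variables `α ⊕ κ` (`α`: scalar variables, `κ`: variables to be read
in a rank-`d+1` algebra with basis `β`, `β 0 = 1`, integer structure constants). Target
polynomials live over `α ⊕ ((κ × Fin (d+1)) ⊕ (Fin (d+1) × Fin (d+1) × Fin (d+1)))`: one
coordinate variable per `κ`-variable and basis index, one variable per structure constant. The
two evaluations `ρK` (source, into `K[σ]`) and `ρZ` (target, into `ℤ[σ]`) are tied by `hsc`,
`hK`, `hβ`; the invariant of a source value `v` with coordinate tuple `q` is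
`aeval ρK v = Σ_l C(β l) · (aeval ρZ (q l))^K`. -/

section Invariant

variable {α κ σ : Type*} {d : ℕ} {K : Type*} [CommRing K] {β : Fin (d + 1) → K}
  {ρK : α ⊕ κ → MvPolynomial σ K}
  {ρZ : α ⊕ ((κ × Fin (d + 1)) ⊕ (Fin (d + 1) × Fin (d + 1) × Fin (d + 1))) → MvPolynomial σ ℤ}

/-- Invariant for a scalar variable: coordinates `(X a, 0, …, 0)`. [cite: Burgisser2000, §4.1] -/
theorem inv_scalarVar (hβ0 : β 0 = 1)
    (hsc : ∀ a, ρK (Sum.inl a) = MvPolynomial.map (Int.castRingHom K) (ρZ (Sum.inl a))) (a : α) :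
    aeval ρK (X (Sum.inl a) : MvPolynomial (α ⊕ κ) ℤ) =
      ∑ l : Fin (d + 1), C (β l) * MvPolynomial.map (Int.castRingHom K)
        (aeval ρZ ((if l = 0 then X (Sum.inl a) else 0 :
          MvPolynomial (α ⊕ ((κ × Fin (d + 1)) ⊕ (Fin (d + 1) × Fin (d + 1) × Fin (d + 1)))) ℤ))) := by
  rw [Fintype.sum_eq_single (0 : Fin (d + 1)) (fun l hl => by simp [hl])]
  simp [hβ0, hsc]

/-- Invariant for a `κ`-variable: coordinates are its coordinate indeterminates.
[cite: Burgisser2000, §4.1] -/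
theorem inv_KVar
    (hK : ∀ k, ρK (Sum.inr k) = ∑ l : Fin (d + 1), C (β l) *
      MvPolynomial.map (Int.castRingHom K) (ρZ (Sum.inr (Sum.inl (k, l))))) (k : κ) :
    aeval ρK (X (Sum.inr k) : MvPolynomial (α ⊕ κ) ℤ) =
      ∑ l : Fin (d + 1), C (β l) * MvPolynomial.map (Int.castRingHom K)
        (aeval ρZ (X (Sum.inr (Sum.inl (k, l))) :
          MvPolynomial (α ⊕ ((κ × Fin (d + 1)) ⊕ (Fin (d + 1) × Fin (d + 1) × Fin (d + 1)))) ℤ)) := by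
  simp [hK]

/-- Invariant for an integer constant: coordinates `(C c, 0, …, 0)`. [cite: Burgisser2000, §4.1] -/
theorem inv_const (hβ0 : β 0 = 1) (c : ℤ) :
    aeval ρK (C c : MvPolynomial (α ⊕ κ) ℤ) =
      ∑ l : Fin (d + 1), C (β l) * MvPolynomial.map (Int.castRingHom K)
        (aeval ρZ ((if l = 0 then C c else 0 :
          MvPolynomial (α ⊕ ((κ × Fin (d + 1)) ⊕ (Fin (d + 1) × Fin (d + 1) × Fin (d + 1)))) ℤ))) := by
  rw [Fintype.sum_eq_single (0 : Fin (d + 1)) (fun l hl => by simp [hl])]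
  simp [hβ0]

/-- Invariant under signed sums (coordinatewise). [cite: Burgisser2000, §4.1] -/
theorem inv_sum {v₁ v₂ : MvPolynomial (α ⊕ κ) ℤ}
    {q₁ q₂ : Fin (d + 1) →
      MvPolynomial (α ⊕ ((κ × Fin (d + 1)) ⊕ (Fin (d + 1) × Fin (d + 1) × Fin (d + 1)))) ℤ}
    (h₁ : aeval ρK v₁ = ∑ l : Fin (d + 1), C (β l) *
      MvPolynomial.map (Int.castRingHom K) (aeval ρZ (q₁ l)))
    (h₂ : aeval ρK v₂ = ∑ l : Fin (d + 1), C (β l) *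
      MvPolynomial.map (Int.castRingHom K) (aeval ρZ (q₂ l))) (a b : ℤ) :
    aeval ρK (a • v₁ + b • v₂) = ∑ l : Fin (d + 1), C (β l) *
      MvPolynomial.map (Int.castRingHom K) (aeval ρZ (a • q₁ l + b • q₂ l)) := by
  simp only [smul_eq_C_mul, map_add, map_mul, eq_intCast, map_intCast, h₁, h₂, mul_add,
    Finset.sum_add_distrib, Finset.mul_sum]
  congr 1 <;> refine Finset.sum_congr rfl fun l _ => by ring

/-- Invariant under products: `(Σ_a β_a A_a)(Σ_b β_b B_b) = Σ_l β_l Σ_{a,b} γ_{abl} A_a B_b`.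
[cite: Burgisser2000, §4.1] -/
theorem inv_prod
    (hβ : ∀ a b : Fin (d + 1), C (β a) * C (β b) = ∑ l : Fin (d + 1),
      MvPolynomial.map (Int.castRingHom K) (ρZ (Sum.inr (Sum.inr (a, b, l)))) * C (β l))
    {v₁ v₂ : MvPolynomial (α ⊕ κ) ℤ}
    {q₁ q₂ : Fin (d + 1) →
      MvPolynomial (α ⊕ ((κ × Fin (d + 1)) ⊕ (Fin (d + 1) × Fin (d + 1) × Fin (d + 1)))) ℤ}
    (h₁ : aeval ρK v₁ = ∑ l : Fin (d + 1), C (β l) *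
      MvPolynomial.map (Int.castRingHom K) (aeval ρZ (q₁ l)))
    (h₂ : aeval ρK v₂ = ∑ l : Fin (d + 1), C (β l) *
      MvPolynomial.map (Int.castRingHom K) (aeval ρZ (q₂ l))) :
    aeval ρK (v₁ * v₂) = ∑ l : Fin (d + 1), C (β l) *
      MvPolynomial.map (Int.castRingHom K) (aeval ρZ
        (((Finset.univ : Finset (Fin (d + 1) × Fin (d + 1))).toList.map fun ab =>
          q₁ ab.1 * q₂ ab.2 * X (Sum.inr (Sum.inr (ab.1, ab.2, l)))).sum)) := by
  -- abbreviations
  set A : Fin (d + 1) → MvPolynomial σ K :=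
    fun a => MvPolynomial.map (Int.castRingHom K) (aeval ρZ (q₁ a)) with hA
  set B : Fin (d + 1) → MvPolynomial σ K :=
    fun b => MvPolynomial.map (Int.castRingHom K) (aeval ρZ (q₂ b)) with hB
  set G : Fin (d + 1) → Fin (d + 1) → Fin (d + 1) → MvPolynomial σ K :=
    fun a b l => MvPolynomial.map (Int.castRingHom K) (ρZ (Sum.inr (Sum.inr (a, b, l)))) with hG
  have hsum : ∀ l : Fin (d + 1), MvPolynomial.map (Int.castRingHom K) (aeval ρZ
      (((Finset.univ : Finset (Fin (d + 1) × Fin (d + 1))).toList.map fun ab =>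
        q₁ ab.1 * q₂ ab.2 * X (Sum.inr (Sum.inr (ab.1, ab.2, l)))).sum)) =
      ∑ a, ∑ b, A a * B b * G a b l := by
    intro l
    rw [map_list_sum, map_list_sum, List.map_map, List.map_map, Finset.sum_map_toList,
      Fintype.sum_prod_type]
    refine Finset.sum_congr rfl fun a _ => Finset.sum_congr rfl fun b _ => ?_
    simp [hA, hB, hG]
  rw [map_mul, h₁, h₂]
  simp_rw [hsum]
  -- bilinear bookkeeping
  calc (∑ a, C (β a) * A a) * (∑ b, C (β b) * B b)
      = ∑ a, ∑ b, (C (β a) * C (β b)) * (A a * B b) := by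
        rw [Finset.sum_mul]
        refine Finset.sum_congr rfl fun a _ => ?_
        rw [Finset.mul_sum]
        refine Finset.sum_congr rfl fun b _ => by ring
    _ = ∑ a, ∑ b, (∑ l, G a b l * C (β l)) * (A a * B b) := by
        refine Finset.sum_congr rfl fun a _ => Finset.sum_congr rfl fun b _ => by rw [hβ]
    _ = ∑ l, C (β l) * ∑ a, ∑ b, A a * B b * G a b l := by
        have hexp : ∀ a b : Fin (d + 1), (∑ l, G a b l * C (β l)) * (A a * B b) =
            ∑ l, C (β l) * (A a * B b * G a b l) := fun a b => by
          rw [Finset.sum_mul]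
          exact Finset.sum_congr rfl fun l _ => by ring
        have hinner : ∀ a : Fin (d + 1), ∑ b, ∑ l, C (β l) * (A a * B b * G a b l) =
            ∑ l, ∑ b, C (β l) * (A a * B b * G a b l) := fun a => Finset.sum_comm
        simp_rw [hexp, hinner]
        rw [Finset.sum_comm]
        refine Finset.sum_congr rfl fun l _ => ?_
        rw [Finset.mul_sum]
        refine Finset.sum_congr rfl fun a _ => ?_
        rw [Finset.mul_sum]

end Invariant


end Summit.ValiantsHypothesis.ValiantsHypothesis.Theorems.AnyonJets.JetConstantElim

end
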